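import Literature.NumberTheory.Automorphic.Liu2021.LemD1AsPrintedIndexed
import Literature.NumberTheory.Automorphic.Liu2021.LemD1LocalInjectivity
import HarnessLib

/-!
# [Liu2021, App. D Lemma D.1 (3)], «⇐» plumbing: an equivariant operator between the carriers of two members with the same
# Step-3 character makes their `ω(μ, ε, χ)` isomorphic

Reproduction ∕ bookkeeping (Literature, THEOREMS ONLY: no definition, no record, no named fact, no `sorry`; nothing of
[Liu2021] is asserted).  Companion of `LemD1AsPrintedIndexedCarrierTransport.lean` (whose generic §1 is `private` and compares a
member only with a RE-PRESENTATION of the same member); here two DIFFERENT members `i, j` of an indexed collection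
`Lf : LemD1IndexedFamily F E n ι` (`LemD1AsPrintedIndexed.lean`) are compared.  Member `t` carries `ω(μ_t, ε_t)` on `V t`
(`Lf.omega t`, a representation of `U(V)(F) = S.U`), its Step-3 character `χ_t` (`Lf.chi t`), and
`ω(μ_t, ε_t, χ_t) = Lf.quot t` is the representation on the maximal quotient `V t ⧸ augmentation (ω_t ∘ scalar) χ_t` on which the
centre `E¹` (`S.scalar`) acts by `χ_t` (`quotRep`, `CentralCharacterQuotient`).

* §1 (generic, any commutative ring `k`, any groups) `exists_quotRep_equiv_of_equivariant` — an `S.U`-equivariant linear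
  equivalence `T : V ≃ V'` (`T (ρ(g) x) = ρ'(g) (T x)`) induces an equivariant linear equivalence of the maximal `χ`-quotients
  `V ⧸ augmentation ρ ζ χ ≃ V' ⧸ augmentation ρ' ζ χ` (`Submodule.Quotient.equiv`; the augmentation submodules correspond).
* §2 **`LemD1IndexedFamily.areIsomorphicRep_quot_of_equivariant`** — for members `i, j` with the SAME Step-3 character
  (`Lf.chi j = Lf.chi i`) and an `S.U`-equivariant `T : V j ≃ V i` between their carriers, `AreIsomorphicRep (Lf.quot j) (Lf.quot i)`
  — the shape of the right-hand side ⟹ left-hand side direction of `LemD1_3AsPrintedI` («… if and only if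
  `(μ', ε', χ') = (μ, ε, χ)`», l. 5233), used by the closers of the `hD3` line a4-liuD3 (stub `stub_iso_of_params`): once the two
  carriers are identified equivariantly (model transport + line-isometry transport + locality of the Kudla section in `μ`),
  the printed isomorphism follows (for carriers that agree on the nose take `T := LinearEquiv.refl`).

References: [Liu2021] Y. Liu, *Fourier–Jacobi cycles and arithmetic relative trace formula*, Camb. J. Math. 9 (2021) =
arXiv:2102.11518, App. D §D.1 Steps 1–3 (l. 5213–5224), Lemma D.1 (3) (l. 5233); [BernsteinZelevinsky1976] §2.1
(representations up to isomorphism).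
-/

noncomputable section

open Literature.RepresentationTheory
open Literature.RepresentationTheory.CentralCharacterQuotient (augmentation quotRep quotRep_mk)

namespace Literature.NumberTheory.Automorphic.Liu2021

/-! ## §1 The maximal `χ`-quotient along an equivariant linear equivalence (generic) -/

namespace LemD1QuotTransport

section Generic

variable {k G Z V V' : Type*} [CommRing k] [Group G] [Group Z] [AddCommGroup V] [Module k V]
  [AddCommGroup V'] [Module k V']

/-- **the `χ`-augmentation submodules correspond under an equivariant linear equivalence**: for `T (ρ g v) = ρ' g (T v)`,
`T` maps `Σ_z range (ρ(ζ z) − χ(z)•id)` onto `Σ_z range (ρ'(ζ z) − χ(z)•id)` (isomorphic representations have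
isomorphic co-invariants). [cite: BernsteinZelevinsky1976, §2.1] -/
theorem augmentation_map_of_equivariant (ρ : Representation k G V) (ρ' : Representation k G V') (ζ : Z →* G)
    (χ : Z →* kˣ) (T : V ≃ₗ[k] V') (hT : ∀ g v, T (ρ g v) = ρ' g (T v)) :
    (augmentation ρ ζ χ).map (T : V →ₗ[k] V') = augmentation ρ' ζ χ := by
  change (⨆ z : Z, LinearMap.range (ρ (ζ z) - (χ z : k) • LinearMap.id)).map (T : V →ₗ[k] V') =
    ⨆ z : Z, LinearMap.range (ρ' (ζ z) - (χ z : k) • LinearMap.id)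
  rw [Submodule.map_iSup]
  refine iSup_congr fun z => ?_
  have hcomp : (T : V →ₗ[k] V').comp (ρ (ζ z) - (χ z : k) • LinearMap.id) =
      (ρ' (ζ z) - (χ z : k) • LinearMap.id).comp (T : V →ₗ[k] V') := by
    ext v
    simp only [LinearMap.coe_comp, Function.comp_apply, LinearMap.sub_apply, LinearMap.smul_apply, LinearMap.id_coe,
      id_eq, LinearEquiv.coe_coe, map_sub, map_smul, hT]
  rw [← LinearMap.range_comp, hcomp, LinearMap.range_comp_of_range_eq_top _ T.range]

/-- **the maximal `χ`-quotients are equivariantly isomorphic along an equivariant linear equivalence of the carriers**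
(`V ⧸ augmentation ρ ζ χ ≃ₗ V' ⧸ augmentation ρ' ζ χ`, `mk v ↦ mk (T v)`, intertwining `quotRep ρ` and `quotRep ρ'`).
[cite: BernsteinZelevinsky1976, §2.1] -/
theorem exists_quotRep_equiv_of_equivariant (ρ : Representation k G V) (ρ' : Representation k G V') {ζ : Z →* G}
    (hζ : ∀ z, ζ z ∈ Subgroup.center G) (χ : Z →* kˣ) (T : V ≃ₗ[k] V') (hT : ∀ g v, T (ρ g v) = ρ' g (T v)) :
    ∃ ē : (V ⧸ augmentation ρ ζ χ) ≃ₗ[k] (V' ⧸ augmentation ρ' ζ χ),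
      (∀ v : V, ē (Submodule.Quotient.mk v) = Submodule.Quotient.mk (T v)) ∧
      ∀ (g : G) (x : V ⧸ augmentation ρ ζ χ), ē (quotRep ρ hζ χ g x) = quotRep ρ' hζ χ g (ē x) := by
  refine ⟨Submodule.Quotient.equiv _ _ T (augmentation_map_of_equivariant ρ ρ' ζ χ T hT), fun v => ?_, fun g x => ?_⟩
  · rw [Submodule.Quotient.equiv_apply, Submodule.mapQ_apply, LinearEquiv.coe_coe]
  · obtain ⟨v, rfl⟩ := Submodule.Quotient.mk_surjective _ x
    rw [quotRep_mk, Submodule.Quotient.equiv_apply, Submodule.Quotient.equiv_apply, Submodule.mapQ_apply,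
      Submodule.mapQ_apply, LinearEquiv.coe_coe, quotRep_mk, hT]

end Generic

section Complex

variable {G Z V : Type*} [Group G] [Group Z] [AddCommGroup V] [Module ℂ V]

/-- the maximal quotients for two EQUAL characters `χ = χ'` (as bundled elements of any subtype of characters) are the same
representation up to the identity — stated as `AreIsomorphicRep` so that consumers need no dependent rewriting.
[cite: Liu2021, App. D Lemma D.1 (3) (l. 5233)] -/
theorem areIsomorphicRep_quotRep_of_eq (ρ : Representation ℂ G V) {ζ : Z →* G} (hζ : ∀ z, ζ z ∈ Subgroup.center G)
    {p : (Z →* ℂˣ) → Prop} {c c' : {χ : Z →* ℂˣ // p χ}} (h : c = c') :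
    AreIsomorphicRep (quotRep ρ hζ c.1) (quotRep ρ hζ c'.1) := by
  subst h
  exact AreIsomorphicRep.refl _

end Complex

end LemD1QuotTransport

/-! ## §2 Two members with the same Step-3 character and equivariantly identified carriers have isomorphic `ω(μ, ε, χ)` -/

namespace LemD1IndexedFamily

variable {F E : Type} [Field F] [ValuativeRel F] [TopologicalSpace F] [CommRing E] [Algebra F E]
  [TopologicalSpace E] [IsTopologicalRing E] {n : ℕ} {ι : Type} (Lf : LemD1IndexedFamily F E n ι)

/-- **«⇐» plumbing for [Liu2021, Lem. D.1 (3)] on an indexed collection**: if members `i, j` have the same Step-3 character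
(`χ_j = χ_i`) and their carriers `ω(μ_j, ε_j)` on `V j`, `ω(μ_i, ε_i)` on `V i` are identified by an `S.U`-equivariant linear
equivalence `T` (`T (ω_j(g) x) = ω_i(g) (T x)`), then `ω(μ_j, ε_j, χ_j) ≅ ω(μ_i, ε_i, χ_i)` (`AreIsomorphicRep (Lf.quot j) (Lf.quot i)`):
the maximal quotient on which the centre acts by the common character is functorial in the carrier.
[cite: Liu2021, App. D Lemma D.1 (3) (l. 5233)] -/
theorem areIsomorphicRep_quot_of_equivariant {i j : ι} (T : Lf.V j ≃ₗ[ℂ] Lf.V i)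
    (hT : ∀ (g : Lf.S.U) (x : Lf.V j), T (Lf.omega j g x) = Lf.omega i g (T x)) (hχ : Lf.chi j = Lf.chi i) :
    AreIsomorphicRep (Lf.quot j) (Lf.quot i) := by
  obtain ⟨ē, -, hē⟩ := LemD1QuotTransport.exists_quotRep_equiv_of_equivariant (Lf.omega j) (Lf.omega i)
    Lf.S.scalar_mem_center (Lf.chi j).1 T hT
  have h₁ : AreIsomorphicRep (Lf.quot j) (quotRep (Lf.omega i) Lf.S.scalar_mem_center (Lf.chi j).1) := ⟨ē, hē⟩
  exact h₁.trans (LemD1QuotTransport.areIsomorphicRep_quotRep_of_eq (Lf.omega i) Lf.S.scalar_mem_center hχ)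

end LemD1IndexedFamily

end Literature.NumberTheory.Automorphic.Liu2021

end
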